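import Summits.QuantumFields.BalabanUV.T4Continuum.Spine.NE1p.DressedTransportCrude

/-!
# T⁴ programme, spine estimate NE1′ (node O3b/H2) — THE PARTNER'S LEVEL REGULARITY IN THE CRUDE COMB ROUTE: base
# regularity + the fluctuation direction's amplitude and COVARIANT CURL (open item (a) of GAPS-T4 I-ne1pleaf06-1, reduced)

Cell `pub-balaban`, sub-cell `t4`, NE1′ formalisation swarm `b2b-balaban-t4-ne1p-formalise-*`, seat LEAF PROVER 06
(own-initiative supplier item NE1p-S7c, journal INTENT CLAIMS.log l.9176, under the seat's rows S7 «F-6 LOCATOR» and S7b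
«F6-CRUDE» = `Spine/NE1p/DressedTransportCrude.lean` p213050); tree target `Summits/QuantumFields/BalabanUV/T4Continuum/Spine/NE1p/`;
ADDITIVE — imports `Spine/NE1p/DressedTransportCrude` ONLY, modifies nothing.

WHAT.  Row S7b's END face `transportLeaf_of_centredExponent_crude` displays ONE crude-attainment binder `hatt`: the booked size
is attained at a UNITARY-LIKE pair `(U₀, U₁)` whose members BOTH have based-plaquette deviation on the generation's block at the
birth-relative rate — `PlaqSup … ‖plaq U₀ − 1‖ (a₀ψ^{k−k′})` (the base: printed TYPE of the premise, [Balaban1985RegularSpaces]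
(1.7) p. 77, [Balaban1988Convergent] (2.34)–(2.35) p. 261 — CONTEXT, never a fact) and `PlaqSup … ‖plaq U₁ − 1‖ (a₁ψ^{k−k′})`
(the PARTNER = base moved by the fresh fluctuation — open item (a) of the seat's locator row GAPS-T4 I-ne1pleaf06-1, asserted
nowhere).  This file REDUCES the partner's binder, in kernel, to the base's plus two displayed numbers of the fluctuation
DIRECTION, using the lineage pv20's chart module `T4DirectionChart` BY NAME:
* §1 `movedBond c A U = exp(c•A)·U` as a unit (inverse `U⁻¹·exp(−c•A)`, `T4DirectionChart.bond_mul_bondInv` ∕ `bondInv_mul_bond`),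
  `movedCfg c A U₀` the moved configuration on `ℤ^d`, and the dictionary `val_plaq_movedCfg`: its based plaquette IS
  `T4DirectionChart.movedPlaq` (orientation of `T4RelativeComb.plaq_eq_basePlaq`) — `rfl`.
* §2 **`plaqSup_movedCfg`** — for a unitary-like base `U₀` with `PlaqSup L z ‖plaq U₀ − 1‖ q₀`, a direction `A : Fld d R` with
  per-bond amplitude `‖A x ν‖ ≤ a`, per-plaquette COVARIANT CURL `‖covSum (U₀-bonds) (A-bonds)‖ ≤ 2a′` on the block, and
  `4‖c‖a ≤ 1`:  `PlaqSup L z ‖plaq (movedCfg c A U₀) − 1‖ (q₀ + 2‖c‖a′ + 16‖c‖²a²)`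
  (`T4DirectionChart.norm_movedPlaq_sub_one_le_xi_sq` at `ξ = 1`, transports bounded by `GUnit.norm_transport_le` ∕
  `GUnit.path₃` ∕ `GUnit.basePlaq`).  The curl enters LINEARLY, the amplitude only QUADRATICALLY.
* §3 `unitaryLike_movedCfg` — the moved bonds are unitary-like when the fluctuation FACTORS `exp(±c•A x ν)` are contractions
  (displayed binder `hW`: true for real fluctuations in a unitary group; false at complex chart points — carved row OG1′-RESID° (i),
  `T4RelativeCombWindow`).
* §4 `crudeAttained_of_movedPartner` — S7b's binder `hatt` with the partner's `PlaqSup (a₁ψ^{k−k′})` DISCHARGED: attaining pairs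
  `(U₀, movedCfg c A U₀)` with base regularity `a₀ψ^{k−k′}`, direction data `(a, a′, ‖c‖)` per step obeying
  `a₀ψ^n + 2‖c‖a′ + 16‖c‖²a² ≤ a₁ψ^n`, `4‖c‖a ≤ 1`, and `hW`; and `transportLeaf_of_centredExponent_moved` = S7b's END BY NAME on
  such pairs (conclusion = the field type of `BookingLeaves.htr` at `C = 4·C_*(a₁+a₀)/r`).

LOCATED READING (the seat's locator, for the owner's Q NE1p-S7-1; nothing asserted).  In the crude route the curl of the fresh
fluctuation does NOT disappear: it re-enters through the PARTNER's level regularity, linearly (`2‖c‖a′`), the amplitude only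
quadratically (`16‖c‖²a²`).  Per CURRENT-unit plaquette a direction SMOOTH ON ITS OWN SCALE (`a′ ≲ a` per current unit — the
printed TYPE of Bałaban's response fields: [Balaban1987RG1] (3.27) p. 275 «|𝐇_{k+1}(□₀,(1/i)log V)|, |∇^{L^{−1}η}𝐇_{k+1}(…)|,
‖𝐇_{k+1}(…)‖_{1,β} < B₃O(1)Mα₀», (3.31)–(3.32) pp. 276–277, (3.37) p. 277 — CONTEXT) keeps the partner level-k regular with
K-free constants and NO averaging∕commutation identity is needed (none is printed: [Balaban1985Averaging] (44)–(50) pp. 24–25 give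
one-step regularity + the linear identity (48) only — the seat's certificate `t4/b2b-balaban-t4-ne1p-formalise-leaf-06/XREAD-F6-rate-B7-B12.md`);
a ROUGH unit-lattice direction (curl ∼ amplitude at block-boundary plaquettes of the birth frame) loses one factor `L` per step —
the owner skeleton's located risk R3.  So what (O2d) asks survives as a DICTIONARY question for leaf F-2∕node H2 («what the
fluctuation variable `z ∈ D b k` of `hFn` IS»), not as a commutation identity for the averaging `Q`.

HONEST FRAMING.  [folklore] normed-algebra bookkeeping over displayed binders; 0 sorry; defs = DATA (`movedBond`, `movedCfg`),
NO `def … : Prop`; nothing of Bałaban's densities asserted; headline «partner's level regularity ⇐ base regularity + direction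
amplitude ∕ covariant curl + contractive factors», never «F-6 proved», never «NE1′ proved».  NE1′ NOT printed, NOT proved;
spine PROVED 0∕9; rung (B)+1 on ONE finite T⁴ — NOT infinite volume, NOT a mass gap, NOT the Clay problem.  HONEST DEPENDENCY:
continuum YM on T⁴ ⇐ BetaPertH ∧ nine spine estimates (0/9 proved); BetaPertH ⇐ (D1) ∧ (D4) ∧ CAP+tail; G-an2-4 gates asym,
D1 and NE2/3/4.
-/

noncomputable section

namespace Summit.QuantumFields.BalabanUV.T4Continuum.NE1p.DressedPartnerRegularity

open NormedSpace MeasureTheory Set Metric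
open Literature.MathematicalPhysics.QuantumFieldTheory.Balaban1983to89
open Literature.MathematicalPhysics.QuantumFieldTheory.Balaban1983to89.T4TrajectoryComparison
open Summit.QuantumFields.BalabanUV.T4Continuum.T4TrajectoryDensityDressed
open B8Lemma1Lattice (e InBlock)
open T4BirthChartTransport (GaugeInvariant BirthSlice RelGauge)
open T4RelativeLadder (UnitaryLike)
open T4RelativeComb (Cfg plaq PlaqSup plaq_eq_basePlaq)
open T4BlockTransport (Fld NDir val latMove latN BlockRel)
open T4DirectionChart (transport GUnit basePlaq covSum movedPlaq)
open T4TrajectoryDensity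

variable {R : Type*} [NormedRing R] [NormedAlgebra ℂ R] [CompleteSpace R] {d : ℕ}

/-! ## §1 The moved configuration on `ℤ^d` and its plaquettes -/

/-- **THE MOVED BOND** [data]: `exp(c•A)·U` as a unit, with inverse `U⁻¹·exp(−c•A)` (`T4DirectionChart.bond_mul_bondInv`,
`bondInv_mul_bond`).  Intended: `U` a bond of the base `U₀`, `A` the fluctuation direction on that bond, `c` its (complex)
coefficient; nothing asserted. [folklore] -/
def movedBond (c : ℂ) (A : R) (U : Rˣ) : Rˣ where
  val := exp (c • A) * (U : R)
  inv := ((U⁻¹ : Rˣ) : R) * exp (-(c • A))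
  val_inv := T4DirectionChart.bond_mul_bondInv c U A
  inv_val := T4DirectionChart.bondInv_mul_bond c U A

/-- The moved bond's value. [folklore] -/
@[simp] theorem val_movedBond (c : ℂ) (A : R) (U : Rˣ) : ((movedBond c A U : Rˣ) : R) = exp (c • A) * (U : R) := rfl

/-- The moved bond's inverse value. [folklore] -/
@[simp] theorem val_inv_movedBond (c : ℂ) (A : R) (U : Rˣ) :
    (((movedBond c A U)⁻¹ : Rˣ) : R) = ((U⁻¹ : Rˣ) : R) * exp (-(c • A)) := rfl

/-- **THE MOVED CONFIGURATION** [data]: `b ↦ exp(c•A(b))·U₀(b)` on the bonds of `ℤ^d`. [folklore] -/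
def movedCfg (c : ℂ) (A : Fld d R) (U₀ : Cfg d R) : Cfg d R := fun x ν => movedBond c (A x ν) (U₀ x ν)

/-- With the zero coefficient nothing moves. [folklore] -/
theorem movedCfg_zero (A : Fld d R) (U₀ : Cfg d R) : movedCfg 0 A U₀ = U₀ := by
  funext x ν
  ext
  simp [movedCfg]

/-- **DICTIONARY**: the based plaquette of the moved configuration IS the chart's `movedPlaq` on the four base bonds and the
four potentials (orientation of `T4RelativeComb.plaq_eq_basePlaq`). [folklore] -/
theorem val_plaq_movedCfg (c : ℂ) (A : Fld d R) (U₀ : Cfg d R) (y : T4BlockTransport.Site d) (ρ ν : Fin d) :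
    ((plaq (movedCfg c A U₀) y ρ ν : Rˣ) : R) =
      movedPlaq c (U₀ y ρ) (U₀ (y + e ρ) ν) (U₀ (y + e ν) ρ) (U₀ y ν) (A y ρ) (A (y + e ρ) ν) (A (y + e ν) ρ) (A y ν) := by
  simp only [plaq, movedCfg, movedPlaq, Units.val_mul, val_movedBond, val_inv_movedBond]

/-! ## §2 The partner's based-plaquette deviation: base + covariant curl (linear) + amplitude (quadratic) -/

/-- **THE PARTNER'S LEVEL REGULARITY FROM THE BASE'S AND THE DIRECTION'S DATA** [bookkeeping]: a unitary-like base `U₀` with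
based-plaquette deviation `≤ q₀` on the block `B(z)`, a direction `A` with per-bond amplitude `‖A x ν‖ ≤ a` and per-plaquette
COVARIANT CURL `‖covSum … ‖ ≤ 2a′` on the block, and `4‖c‖a ≤ 1` give the moved configuration based-plaquette deviation
`≤ q₀ + 2‖c‖a′ + 16‖c‖²a²` on the block — `T4DirectionChart.norm_movedPlaq_sub_one_le_xi_sq` at `ξ = 1` BY NAME (the transported
potentials are bounded by `a` because transport by G-valued units is norm-non-increasing).  The curl enters linearly, the
amplitude quadratically. [folklore] -/
theorem plaqSup_movedCfg {L : ℕ} {z : T4BlockTransport.Site d} {U₀ : Cfg d R} {A : Fld d R} {c : ℂ} {q₀ a a' : ℝ}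
    (hU₀ : ∀ x ν, UnitaryLike (U₀ x ν))
    (hq₀ : PlaqSup L z (fun y ρ ν => ‖(plaq U₀ y ρ ν : R) - 1‖) q₀)
    (ha : ∀ x ν, ‖A x ν‖ ≤ a)
    (hcov : ∀ (y : T4BlockTransport.Site d) (ρ ν : Fin d), ρ ≠ ν → InBlock L z y → InBlock L z (y + e ρ) →
      InBlock L z (y + e ν) → InBlock L z (y + e ρ + e ν) →
      ‖covSum (U₀ y ρ) (U₀ (y + e ρ) ν) (U₀ (y + e ν) ρ) (U₀ y ν) (A y ρ) (A (y + e ρ) ν) (A (y + e ν) ρ) (A y ν)‖ ≤ 2 * a')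
    (hT : 4 * ‖c‖ * a ≤ 1) :
    PlaqSup L z (fun y ρ ν => ‖(plaq (movedCfg c A U₀) y ρ ν : R) - 1‖) (q₀ + 2 * ‖c‖ * a' + 16 * ‖c‖ ^ 2 * a ^ 2) := by
  intro y ρ ν hne h1 h2 h3 h4
  have g1 : GUnit (U₀ y ρ) := hU₀ _ _
  have g2 : GUnit (U₀ (y + e ρ) ν) := hU₀ _ _
  have g3 : GUnit (U₀ (y + e ν) ρ) := hU₀ _ _
  have g4 : GUnit (U₀ y ν) := hU₀ _ _
  have hb : ‖(plaq U₀ y ρ ν : R) - 1‖ ≤ q₀ := hq₀ y ρ ν hne h1 h2 h3 h4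
  show ‖((plaq (movedCfg c A U₀) y ρ ν : Rˣ) : R) - 1‖ ≤ _
  rw [val_plaq_movedCfg]
  have h := T4DirectionChart.norm_movedPlaq_sub_one_le_xi_sq c (U₀ y ρ) (U₀ (y + e ρ) ν) (U₀ (y + e ν) ρ) (U₀ y ν)
    (A y ρ) (A (y + e ρ) ν) (A (y + e ν) ρ) (A y ν) (ξ := 1) (σ := ‖c‖) (a := a) (a' := a') (δb := q₀)
    zero_le_one (norm_nonneg c) (by rw [one_mul]) (g1.basePlaq g2 g3 g4).1
    (by rw [one_pow, mul_one]; exact hb) (ha _ _) ((g1.norm_transport_le _).trans (ha _ _))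
    (((g1.path₃ g2 g3).norm_transport_le _).trans (ha _ _)) (((g1.basePlaq g2 g3 g4).norm_transport_le _).trans (ha _ _))
    (by rw [mul_one]; exact hcov y ρ ν hne h1 h2 h3 h4) (by rw [mul_one]; exact hT)
  simpa only [one_pow, one_mul] using h

/-- [arith] The same at the birth-relative RATE: base deviation `≤ a₀ψ^n` and direction data with
`a₀ψ^n + 2‖c‖a′ + 16‖c‖²a² ≤ a₁ψ^n` give the partner's deviation `≤ a₁ψ^n` — the second `PlaqSup` of row S7b's `hatt`. [folklore] -/
theorem plaqSup_movedCfg_rate {L : ℕ} {z : T4BlockTransport.Site d} {U₀ : Cfg d R} {A : Fld d R} {c : ℂ}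
    {a₀ a₁ ψ a a' : ℝ} {n : ℕ} (hU₀ : ∀ x ν, UnitaryLike (U₀ x ν))
    (hq₀ : PlaqSup L z (fun y ρ ν => ‖(plaq U₀ y ρ ν : R) - 1‖) (a₀ * ψ ^ n))
    (ha : ∀ x ν, ‖A x ν‖ ≤ a)
    (hcov : ∀ (y : T4BlockTransport.Site d) (ρ ν : Fin d), ρ ≠ ν → InBlock L z y → InBlock L z (y + e ρ) →
      InBlock L z (y + e ν) → InBlock L z (y + e ρ + e ν) →
      ‖covSum (U₀ y ρ) (U₀ (y + e ρ) ν) (U₀ (y + e ν) ρ) (U₀ y ν) (A y ρ) (A (y + e ρ) ν) (A (y + e ν) ρ) (A y ν)‖ ≤ 2 * a')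
    (hT : 4 * ‖c‖ * a ≤ 1) (hrate : a₀ * ψ ^ n + 2 * ‖c‖ * a' + 16 * ‖c‖ ^ 2 * a ^ 2 ≤ a₁ * ψ ^ n) :
    PlaqSup L z (fun y ρ ν => ‖(plaq (movedCfg c A U₀) y ρ ν : R) - 1‖) (a₁ * ψ ^ n) :=
  fun y ρ ν hne h1 h2 h3 h4 => (plaqSup_movedCfg hU₀ hq₀ ha hcov hT y ρ ν hne h1 h2 h3 h4).trans hrate

/-! ## §3 Unitary-likeness of the moved configuration -/

/-- **THE MOVED BONDS ARE UNITARY-LIKE WHEN THE FLUCTUATION FACTORS ARE CONTRACTIONS** [bookkeeping]: `‖exp(c•A x ν)‖ ≤ 1` and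
`‖exp(−c•A x ν)‖ ≤ 1` on every bond (displayed binder — true for a real fluctuation in a unitary group, false at complex chart
points) and a unitary-like base give a unitary-like moved configuration. [folklore] -/
theorem unitaryLike_movedCfg {U₀ : Cfg d R} {A : Fld d R} {c : ℂ} (hU₀ : ∀ x ν, UnitaryLike (U₀ x ν))
    (hW : ∀ x ν, ‖exp (c • A x ν)‖ ≤ 1 ∧ ‖exp (-(c • A x ν))‖ ≤ 1) :
    ∀ x ν, UnitaryLike (movedCfg c A U₀ x ν) := by
  intro x ν
  refine ⟨?_, ?_⟩
  · show ‖((movedBond c (A x ν) (U₀ x ν) : Rˣ) : R)‖ ≤ 1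
    rw [val_movedBond]
    calc ‖exp (c • A x ν) * (U₀ x ν : R)‖ ≤ ‖exp (c • A x ν)‖ * ‖(U₀ x ν : R)‖ := norm_mul_le _ _
      _ ≤ 1 * 1 := mul_le_mul (hW x ν).1 (hU₀ x ν).1 (norm_nonneg _) zero_le_one
      _ = 1 := one_mul 1
  · show ‖(((movedBond c (A x ν) (U₀ x ν))⁻¹ : Rˣ) : R)‖ ≤ 1
    rw [val_inv_movedBond]
    calc ‖(((U₀ x ν)⁻¹ : Rˣ) : R) * exp (-(c • A x ν))‖ ≤ ‖(((U₀ x ν)⁻¹ : Rˣ) : R)‖ * ‖exp (-(c • A x ν))‖ :=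
          norm_mul_le _ _
      _ ≤ 1 * 1 := mul_le_mul (hU₀ x ν).2 (hW x ν).2 (norm_nonneg _) zero_le_one
      _ = 1 := one_mul 1

/-! ## §4 Row S7b's crude attainment with the partner's regularity DISCHARGED, and the END on moved pairs -/

section Attainment

variable {B : T4TermFormat.Booking} {T : Trajectory B} {F : Type*} [NormedAddCommGroup F]

/-- **S7b's `hatt` FROM MOVED PARTNERS** [bookkeeping]: if, per generation `(b, k′)` and step `k` under the history and for every
`ε > 0`, the instantiation exhibits a unitary-like base `U₀` (value in the window `𝒦 b k′ k`, based-plaquette deviation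
`≤ a₀ψ^{k−k′}` on the generation's block), a fluctuation direction `A` with coefficient `c`, per-bond amplitude `a`, per-plaquette
covariant curl `a′` (relative to `U₀`) with `4‖c‖a ≤ 1` and `a₀ψ^{k−k′} + 2‖c‖a′ + 16‖c‖²a² ≤ a₁ψ^{k−k′}`, contractive factors
`exp(±c•A)`, and the booked size attained by the response at the pair `(U₀, movedCfg c A U₀)` — THEN the crude attainment binder
`hatt` of `DressedTransportCrude.transportLeaf_of_centredExponent_crude` holds VERBATIM (partner := the moved configuration,
its `PlaqSup` by §2, its unitary-likeness by §3).  Any `Gate`. [folklore] -/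
theorem crudeAttained_of_movedPartner {Gate : ℕ → Prop} {Fn : B.Birth → ℕ → ℕ → Fld d R → F}
    {Lg : B.Birth → ℕ → ℕ} {zg : B.Birth → ℕ → T4BlockTransport.Site d} {𝒦 : B.Birth → ℕ → ℕ → Set (Fld d R)}
    {a₀ a₁ ψ : ℝ}
    (hmoved : ∀ (b : B.Birth) (k' k : ℕ), B.birthScale b ≤ k' → k' ≤ k → k ≤ B.K → RanBelow Gate k → ∀ ε > 0,
      ∃ (U₀ : Cfg d R) (A : Fld d R) (c : ℂ) (a a' : ℝ), val U₀ ∈ 𝒦 b k' k ∧ (∀ x ν, UnitaryLike (U₀ x ν)) ∧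
        PlaqSup (Lg b k') (zg b k') (fun y ρ ν => ‖(plaq U₀ y ρ ν : R) - 1‖) (a₀ * ψ ^ (k - k')) ∧
        (∀ x ν, ‖A x ν‖ ≤ a) ∧
        (∀ (y : T4BlockTransport.Site d) (ρ ν : Fin d), ρ ≠ ν → InBlock (Lg b k') (zg b k') y →
          InBlock (Lg b k') (zg b k') (y + e ρ) → InBlock (Lg b k') (zg b k') (y + e ν) →
          InBlock (Lg b k') (zg b k') (y + e ρ + e ν) →
          ‖covSum (U₀ y ρ) (U₀ (y + e ρ) ν) (U₀ (y + e ν) ρ) (U₀ y ν) (A y ρ) (A (y + e ρ) ν) (A (y + e ν) ρ) (A y ν)‖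
            ≤ 2 * a') ∧
        4 * ‖c‖ * a ≤ 1 ∧ a₀ * ψ ^ (k - k') + 2 * ‖c‖ * a' + 16 * ‖c‖ ^ 2 * a ^ 2 ≤ a₁ * ψ ^ (k - k') ∧
        (∀ x ν, ‖exp (c • A x ν)‖ ≤ 1 ∧ ‖exp (-(c • A x ν))‖ ≤ 1) ∧
        T.lin b k' k ≤ ‖Fn b k' k (val (movedCfg c A U₀)) - Fn b k' k (val U₀)‖ + ε) :
    ∀ (b : B.Birth) (k' k : ℕ), B.birthScale b ≤ k' → k' ≤ k → k ≤ B.K → RanBelow Gate k → ∀ ε > 0,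
      ∃ U₀ U₁ : Cfg d R, val U₀ ∈ 𝒦 b k' k ∧ (∀ x ν, UnitaryLike (U₀ x ν)) ∧ (∀ x ν, UnitaryLike (U₁ x ν)) ∧
        PlaqSup (Lg b k') (zg b k') (fun y ρ ν => ‖(plaq U₁ y ρ ν : R) - 1‖) (a₁ * ψ ^ (k - k')) ∧
        PlaqSup (Lg b k') (zg b k') (fun y ρ ν => ‖(plaq U₀ y ρ ν : R) - 1‖) (a₀ * ψ ^ (k - k')) ∧
        T.lin b k' k ≤ ‖Fn b k' k (val U₁) - Fn b k' k (val U₀)‖ + ε := by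
  intro b k' k hbk' hk'k hk hran ε hε
  obtain ⟨U₀, A, c, a, a', h𝒦, hU₀, hq₀, ha, hcov, hT, hrate, hW, hle⟩ := hmoved b k' k hbk' hk'k hk hran ε hε
  exact ⟨U₀, movedCfg c A U₀, h𝒦, hU₀, unitaryLike_movedCfg hU₀ hW,
    plaqSup_movedCfg_rate hU₀ hq₀ ha hcov hT hrate, hq₀, hle⟩

end Attainment

section EndF

variable [NormOneClass R] [MeasurableSpace R]
variable {B : T4TermFormat.Booking} {T : Trajectory B} {F : Type*} [NormedAddCommGroup F] [NormedSpace ℂ F]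
  [CompleteSpace F]

/-- **S7b's END ON MOVED PAIRS** [bookkeeping]: `DressedTransportCrude.transportLeaf_of_centredExponent_crude` BY NAME with its
crude attainment `hatt` REPLACED by the moved-partner data `hmoved` of `crudeAttained_of_movedPartner` — so of leaf F-6 what stays
displayed is: the BASE's level regularity (printed TYPE of the premise), the fluctuation direction's amplitude `a` and covariant
curl `a′` per step with `a₀ψ^n + 2‖c‖a′ + 16‖c‖²a² ≤ a₁ψ^n`, contractive factors, and the attainment; every other binder is
END-F's verbatim; conclusion = the field type of `BookingLeaves.htr` at `C = 4·C_*(a₁+a₀)/r`.  «L-T ⇐ F-1…F-5, F-7, F-9 + base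
level regularity + direction amplitude ∕ covariant curl», never «F-6 proved». [folklore] -/
theorem transportLeaf_of_centredExponent_moved {Fn : B.Birth → ℕ → ℕ → Fld d R → F}
    {Lg : B.Birth → ℕ → ℕ} {zg : B.Birth → ℕ → T4BlockTransport.Site d} {𝒦 : B.Birth → ℕ → ℕ → Set (Fld d R)}
    {ref : B.Birth → ℕ → Fld d R → Fld d R} {base : B.Birth → ℕ → Fld d R → ℝ}
    {𝒜 𝒬 : B.Birth → ℕ → Fld d R → Fld d R → ℂ} {q : B.Birth → ℕ → Fld d R → ℂ}
    {μ : B.Birth → ℕ → Measure (Fld d R)} {z₀ : B.Birth → ℕ → Fld d R} {D : B.Birth → ℕ → Set (Fld d R)}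
    {a₀ a₁ Cst ψ w r m : ℝ} {s θ : B.Birth → ℕ → ℝ} {α : ℕ → ℝ}
    {ϱ : B.Birth → ℕ → ℕ → ℝ} {S : ℕ → B.Birth → Finset B.Birth}
    (hα : ∀ i, 0 ≤ α i) (hr : 0 < r) (hw : 0 < w)
    (hψ : 0 < ψ) (hψ1 : ψ ≤ 1) (ha : 0 < a₁ + a₀) (hCst : 0 < Cst)
    (hC : ∀ b k', ((d : ℝ) - 1) * ((Lg b k' : ℝ) - 1) ≤ Cst) (hww : Cst * (a₁ + a₀) ≤ w)
    (hsl : ∀ (b : B.Birth) (k' : ℕ), B.birthScale b ≤ k' → k' ≤ B.K →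
      RanBelow (budgetGate T s m S (4 * (Cst * (a₁ + a₀)) / r) (fun i => ψ * α i)) k' →
      BirthSlice (Fn b k' k') latMove latN (𝒦 b k' k') w r (T.gen b k'))
    (hFn : ∀ (b : B.Birth) (k' k : ℕ), B.birthScale b ≤ k' → k' ≤ k → k + 1 ≤ B.K →
      RanBelow (budgetGate T s m S (4 * (Cst * (a₁ + a₀)) / r) (fun i => ψ * α i)) (k + 1) →
      ∀ U, Fn b k' (k + 1) U =
        wOp (expWeight (base b k) (𝒜 b k + 𝒬 b k)) (μ b k) (z₀ b k) U (fun z => Fn b k' k (U + z)))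
    (h𝒢 : ∀ (b : B.Birth) (k' k : ℕ), B.birthScale b ≤ k' → k' ≤ k → k + 1 ≤ B.K →
      RanBelow (budgetGate T s m S (4 * (Cst * (a₁ + a₀)) / r) (fun i => ψ * α i)) (k + 1) →
      ∀ U, (fun z => Fn b k' k (U + z)) ∈ BddClass F (μ b k))
    (hD : ∀ b k, (D b k).Nonempty) (hϱ : ∀ b k' k, 0 < ϱ b k' k)
    (hB : ∀ (b : B.Birth) (k' k : ℕ), B.birthScale b ≤ k' → k' ≤ k → k + 1 ≤ B.K →
      RanBelow (budgetGate T s m S (4 * (Cst * (a₁ + a₀)) / r) (fun i => ψ * α i)) (k + 1) →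
      RealBaseAt (ref b k) (base b k) (𝒜 b k) (μ b k) (𝒦 b k' (k + 1)))
    (hE : ∀ (b : B.Birth) (k' k : ℕ), B.birthScale b ≤ k' → k' ≤ k → k + 1 ≤ B.K →
      RanBelow (budgetGate T s m S (4 * (Cst * (a₁ + a₀)) / r) (fun i => ψ * α i)) (k + 1) →
      ExponentSliceAt (ref b k) (𝒜 b k) (μ b k) latMove latN (𝒦 b k' (k + 1)) w (ϱ b k' k) (s b k))
    (hP : ∀ (b : B.Birth) (k' k : ℕ), B.birthScale b ≤ k' → k' ≤ k → k + 1 ≤ B.K →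
      RanBelow (budgetGate T s m S (4 * (Cst * (a₁ + a₀)) / r) (fun i => ψ * α i)) (k + 1) →
      PertSlice (fun U z => 𝒬 b k U z - q b k U) (μ b k) latMove latN (𝒦 b k' (k + 1)) w (ϱ b k' k)
        (m * ∑ f ∈ S k b, T.envVar (4 * (Cst * (a₁ + a₀)) / r) (fun i => ψ * α i) f k))
    (hDμ : ∀ b k, ∀ᵐ z ∂μ b k, z ∈ D b k)
    (hN1 : ∀ (b : B.Birth) (k' k : ℕ), B.birthScale b ≤ k' → k' ≤ k → k + 1 ≤ B.K →
      ∀ z ∈ D b k, ∀ U ∈ 𝒦 b k' (k + 1), U + z ∈ 𝒦 b k' k)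
    (hN2 : ∀ (b : B.Birth) (k' k : ℕ), B.birthScale b ≤ k' → k' ≤ k → k + 1 ≤ B.K →
      ∀ U₀ ∈ 𝒦 b k' (k + 1), ∀ p : NDir d R, latN p ≤ w → ∀ z' ∈ D b k, latMove U₀ p 1 + z' ∈ 𝒦 b k' k)
    (hdiam : ∀ b k, ∀ z ∈ D b k, ∀ z' ∈ D b k, ∀ x ν, ‖z x ν - z' x ν‖ ≤ θ b k)
    (hθ : ∀ b k, 0 < θ b k ∧ θ b k ≤ w)
    (hdom : ∀ (b : B.Birth) (k' k : ℕ), B.birthScale b ≤ k' → k' ≤ k → k + 1 ≤ B.K →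
      Real.exp 3 * (1 + 4 * θ b k / ϱ b k' k) ≤ α k)
    (hinv : ∀ b k' k, GaugeInvariant (BlockRel (Lg b k') (zg b k')) (Fn b k' k))
    (hmoved : ∀ (b : B.Birth) (k' k : ℕ), B.birthScale b ≤ k' → k' ≤ k → k ≤ B.K →
      RanBelow (budgetGate T s m S (4 * (Cst * (a₁ + a₀)) / r) (fun i => ψ * α i)) k → ∀ ε > 0,
      ∃ (U₀ : Cfg d R) (A : Fld d R) (c : ℂ) (a a' : ℝ), val U₀ ∈ 𝒦 b k' k ∧ (∀ x ν, UnitaryLike (U₀ x ν)) ∧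
        PlaqSup (Lg b k') (zg b k') (fun y ρ ν => ‖(plaq U₀ y ρ ν : R) - 1‖) (a₀ * ψ ^ (k - k')) ∧
        (∀ x ν, ‖A x ν‖ ≤ a) ∧
        (∀ (y : T4BlockTransport.Site d) (ρ ν : Fin d), ρ ≠ ν → InBlock (Lg b k') (zg b k') y →
          InBlock (Lg b k') (zg b k') (y + e ρ) → InBlock (Lg b k') (zg b k') (y + e ν) →
          InBlock (Lg b k') (zg b k') (y + e ρ + e ν) →
          ‖covSum (U₀ y ρ) (U₀ (y + e ρ) ν) (U₀ (y + e ν) ρ) (U₀ y ν) (A y ρ) (A (y + e ρ) ν) (A (y + e ν) ρ) (A y ν)‖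
            ≤ 2 * a') ∧
        4 * ‖c‖ * a ≤ 1 ∧ a₀ * ψ ^ (k - k') + 2 * ‖c‖ * a' + 16 * ‖c‖ ^ 2 * a ^ 2 ≤ a₁ * ψ ^ (k - k') ∧
        (∀ x ν, ‖exp (c • A x ν)‖ ≤ 1 ∧ ‖exp (-(c • A x ν))‖ ≤ 1) ∧
        T.lin b k' k ≤ ‖Fn b k' k (val (movedCfg c A U₀)) - Fn b k' k (val U₀)‖ + ε) :
    T.TransportsFromVar (4 * (Cst * (a₁ + a₀)) / r) (fun i => ψ * α i)
      (budgetGate T s m S (4 * (Cst * (a₁ + a₀)) / r) (fun i => ψ * α i)) :=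
  DressedTransportCrude.transportLeaf_of_centredExponent_crude hα hr hw hψ hψ1 ha hCst hC hww hsl hFn h𝒢 hD hϱ hB hE hP
    hDμ hN1 hN2 hdiam hθ hdom hinv (crudeAttained_of_movedPartner (T := T) hmoved)

end EndF

/-! ## §5 (v1.1, APPEND-ONLY) The covariant curl from the direction's COVARIANT DIFFERENCE QUOTIENTS: `a′ := s + 2q₀a` -/

section CovDiff

variable {R : Type*} [NormedRing R]

/-- **THE COVARIANT PLAQUETTE SUM FROM COVARIANT DIFFERENCES** [bookkeeping]: around a plaquette with G-valued base bonds
`U₁ … U₄` (forward `1 = (x, ρ)`, `2 = (x+e_ρ, ν)`, backward `3 = (x+e_ν, ρ)`, `4 = (x, ν)`), if the direction's two COVARIANT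
DIFFERENCE QUOTIENTS at the base point are bounded — `‖U₁·A₂·U₁⁻¹ − A₄‖ ≤ s` (`∇^U_ρ A_ν`) and `‖U₄·A₃·U₄⁻¹ − A₁‖ ≤ s`
(`∇^U_ν A_ρ`) —, its potentials by `a` and the base plaquette deviation by `q`, then `‖covSum‖ ≤ 2s + 4qa`: the exactly
covariant sum `covSum′ = (U₁A₂U₁⁻¹ − A₄) − (U₄A₃U₄⁻¹ − A₁)` is `≤ 2s`, and `covSum` differs from it by `≤ 2q(‖A₃‖ + ‖A₄‖)`
(`T4DirectionChart.norm_covSum_sub_covSum'_le`).  Cell dictionary (nothing printed asserted): `s` = `ξ×` the sup of the covariant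
difference quotients `|∇^ξ_U 𝐀|` — the THIRD member of the printed direction window [Balaban1987RG1] (3.14) p. 272 ∕ the class
(3.31) p. 276 (TYPE ∕ CONTEXT). [folklore] -/
theorem norm_covSum_le_of_covDiff {U₁ U₂ U₃ U₄ : Rˣ} (h₁ : GUnit U₁) (h₂ : GUnit U₂) (h₃ : GUnit U₃) (h₄ : GUnit U₄)
    {A₁ A₂ A₃ A₄ : R} {s a q : ℝ} (hd₁ : ‖transport U₁ A₂ - A₄‖ ≤ s) (hd₂ : ‖transport U₄ A₃ - A₁‖ ≤ s)
    (ha₃ : ‖A₃‖ ≤ a) (ha₄ : ‖A₄‖ ≤ a) (hq : ‖((basePlaq U₁ U₂ U₃ U₄ : Rˣ) : R) - 1‖ ≤ q) :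
    ‖covSum U₁ U₂ U₃ U₄ A₁ A₂ A₃ A₄‖ ≤ 2 * s + 4 * q * a := by
  have hcov' : T4DirectionChart.covSum' U₁ U₄ A₁ A₂ A₃ A₄ = (transport U₁ A₂ - A₄) - (transport U₄ A₃ - A₁) := by
    rw [T4DirectionChart.covSum']
    abel
  have h' : ‖T4DirectionChart.covSum' U₁ U₄ A₁ A₂ A₃ A₄‖ ≤ 2 * s := by
    rw [hcov']
    exact (norm_sub_le _ _).trans (by linarith)
  have hdiff := T4DirectionChart.norm_covSum_sub_covSum'_le h₁ h₂ h₃ h₄ A₁ A₂ A₃ A₄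
  have hq0 : 0 ≤ q := (norm_nonneg _).trans hq
  have hsum : ‖A₃‖ + ‖A₄‖ ≤ 2 * a := by linarith
  have e : covSum U₁ U₂ U₃ U₄ A₁ A₂ A₃ A₄ =
      T4DirectionChart.covSum' U₁ U₄ A₁ A₂ A₃ A₄ + (covSum U₁ U₂ U₃ U₄ A₁ A₂ A₃ A₄ -
        T4DirectionChart.covSum' U₁ U₄ A₁ A₂ A₃ A₄) := by abel
  calc ‖covSum U₁ U₂ U₃ U₄ A₁ A₂ A₃ A₄‖
      ≤ ‖T4DirectionChart.covSum' U₁ U₄ A₁ A₂ A₃ A₄‖ +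
          ‖covSum U₁ U₂ U₃ U₄ A₁ A₂ A₃ A₄ - T4DirectionChart.covSum' U₁ U₄ A₁ A₂ A₃ A₄‖ := by
        rw [e]; simpa using norm_add_le (T4DirectionChart.covSum' U₁ U₄ A₁ A₂ A₃ A₄)
          (covSum U₁ U₂ U₃ U₄ A₁ A₂ A₃ A₄ - T4DirectionChart.covSum' U₁ U₄ A₁ A₂ A₃ A₄)
    _ ≤ 2 * s + 2 * ‖((basePlaq U₁ U₂ U₃ U₄ : Rˣ) : R) - 1‖ * (‖A₃‖ + ‖A₄‖) := add_le_add h' hdiff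
    _ ≤ 2 * s + 2 * q * (2 * a) := by gcongr
    _ = 2 * s + 4 * q * a := by ring

end CovDiff

section MovedCovDiff

variable {R : Type*} [NormedRing R] [NormedAlgebra ℂ R] [CompleteSpace R] {d : ℕ}

/-- **THE PARTNER'S LEVEL REGULARITY FROM THE DIRECTION'S AMPLITUDE AND COVARIANT DIFFERENCE QUOTIENTS** [bookkeeping]: §2 with
the curl bound supplied by `norm_covSum_le_of_covDiff` — a unitary-like base with based-plaquette deviation `≤ q₀` on the block, a
direction with per-bond amplitude `≤ a` and per-corner COVARIANT DIFFERENCE QUOTIENTS `≤ s` on the block (`‖U₀(y,ρ)·A(y+e_ρ,ν)·U₀(y,ρ)⁻¹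
− A(y,ν)‖ ≤ s` for both orientations), and `4‖c‖a ≤ 1` ⟹ the moved configuration's deviation is
`≤ q₀ + 2‖c‖·(s + 2q₀a) + 16‖c‖²a²`.  The direction's data are now EXACTLY the two members `|𝐀|`, `|∇_U 𝐀|` of the printed window
(TYPE); «smooth on its own scale» = `s ≲ a` per current unit. [folklore] -/
theorem plaqSup_movedCfg_of_covDiff {L : ℕ} {z : T4BlockTransport.Site d} {U₀ : Cfg d R} {A : Fld d R} {c : ℂ} {q₀ a s : ℝ}
    (hU₀ : ∀ x ν, UnitaryLike (U₀ x ν))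
    (hq₀ : PlaqSup L z (fun y ρ ν => ‖(plaq U₀ y ρ ν : R) - 1‖) q₀)
    (ha : ∀ x ν, ‖A x ν‖ ≤ a)
    (hcd : ∀ (y : T4BlockTransport.Site d) (ρ ν : Fin d), ρ ≠ ν → InBlock L z y → InBlock L z (y + e ρ) →
      InBlock L z (y + e ν) → InBlock L z (y + e ρ + e ν) →
      ‖transport (U₀ y ρ) (A (y + e ρ) ν) - A y ν‖ ≤ s ∧ ‖transport (U₀ y ν) (A (y + e ν) ρ) - A y ρ‖ ≤ s)
    (hT : 4 * ‖c‖ * a ≤ 1) :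
    PlaqSup L z (fun y ρ ν => ‖(plaq (movedCfg c A U₀) y ρ ν : R) - 1‖)
      (q₀ + 2 * ‖c‖ * (s + 2 * q₀ * a) + 16 * ‖c‖ ^ 2 * a ^ 2) := by
  refine plaqSup_movedCfg hU₀ hq₀ ha (fun y ρ ν hne h1 h2 h3 h4 => ?_) hT
  obtain ⟨hd₁, hd₂⟩ := hcd y ρ ν hne h1 h2 h3 h4
  have h := norm_covSum_le_of_covDiff (hU₀ y ρ) (hU₀ (y + e ρ) ν) (hU₀ (y + e ν) ρ) (hU₀ y ν) hd₁ hd₂ (ha _ _) (ha _ _)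
    (hq₀ y ρ ν hne h1 h2 h3 h4)
  linarith

end MovedCovDiff

end Summit.QuantumFields.BalabanUV.T4Continuum.NE1p.DressedPartnerRegularity

end
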